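import Literature.NumberTheory.Multiplicative.Balazard1990.Compute
import HarnessLib

/-!
# Balazard (1990), Question 2 for `σ` — kernel pass over the finite range `x = 1, …, 4095`

Source: M. Balazard, *Quelques exemples de suites unimodales en théorie des nombres*, Séminaire de Théorie des
Nombres de Bordeaux (2) **2** (1990) 13–30, doi:10.5802/jtnb.17 (open access) [Balazard1990], p. 27 Question 2
(with p. 14: log-concavity, p. 20: `σ(x,k)`).  PRIMARY READ from the vendored page-image excerpt of the H21 archive
(`archive/2001-boxes/tp/literature/sources/balazard-1990-jtnb2-unimodales/EXCERPTS-prove-tp-omega-count-log-concavity.md`,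
§BZ9 = p. 27, §BZ5 = p. 14, §BZ6 = p. 20).

Four KERNEL evaluations (`decide +kernel`, standard axioms; ≈ 1024 trial-division factorisations each): the row
pass `finRun` of `Literature.NumberTheory.Multiplicative.Balazard1990.Compute` from `finInit` reaches the recorded rows `finState1024`, `finState2048`,
`finState3072`, and ends at `x = 4095` with flag `true` ("log-concavity of `(σ(x,0..12))`, both indexings, agrees
with `x ∈ E` for every `x` so far").  Meaning: `finCheck_4095` / `isLogConcave_sigma_iff_mem_E_of_lt` in
`Literature.NumberTheory.Multiplicative.Balazard1990.FiniteRange`.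

Provenance: refutations bundle `papers/_cross/refutations` (H21 seat pub-refute-2, 2026-08-18), package module
`Refutations.Balazard1990.KernelFin1..4 (merged)`, moved into the tree under the Lean-in-tree rule (human 2026-08-18).  The
classification `E` and the proof structure are the 2001 H21 programme's (archive route `tp/omega-count-log-concavity`,
Theorem 1, "review: upheld"); the bundle's exact Python certificate `numerics/balazard1990/check_balazard_sigma_Q2.py`
checks the same two legs independently.
-/

namespace Literature.NumberTheory.Multiplicative.Balazard1990

/-- Kernel certificate, first chunk of the finite-range pass: `x = 1, …, 1024`. [folklore] -/
theorem finRun_chunk1 : finRun 0 finInit 1024 = finState1024 := by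
  decide +kernel

/-- Kernel certificate, second chunk: `x = 1025, …, 2048`. [folklore] -/
theorem finRun_chunk2 : finRun 1024 finState1024 1024 = finState2048 := by
  decide +kernel

/-- Kernel certificate, third chunk: `x = 2049, …, 3072`. [folklore] -/
theorem finRun_chunk3 : finRun 2048 finState2048 1024 = finState3072 := by
  decide +kernel

/-- Kernel certificate, last chunk: `x = 3073, …, 4095`, final flag `true`. [folklore] -/
theorem finRun_chunk4 : (finRun 3072 finState3072 1023).2 = true := by
  decide +kernel

end Literature.NumberTheory.Multiplicative.Balazard1990
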